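import Summits.CriticalPhenomena.PercolationContinuityZ3.Theorems.Transplant.SkelFrmFromBChoiceZoneKPx
import HarnessLib

/-!
# U_s execution (RULING D-Us / Us-R3, lead g22 2026-08-26; GEN DESIGN NOTES K-1/K-2 of the design owner): «SkelFrmFromBParamsKitBump» — THE KIT-SIDE
# DEVICES the (R)/(C)/(F) GEN columns use to re-dimension the (S0) apron kits under proxies, WITHOUT any new kit numerics:
# (K-1) the BUMPED RECORD `DataNS.bumpR` (radius `R ↦ R + D` strictly above the zone scale `M_u`), read by the kit functions `KS.*` / `KS0.*` only;
# (K-2) the RAISED KIT INDEX (`mk ≤ KS.RK t D mk` under `AtQNQ`, so `mkP := RK mk + D` serves `RK mk + D ≤ RK mkP`)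

builds on p205010 (kernel theorem, internal audit signed; external expert review pending) — nothing in this file uses p205010; NOTHING is claimed about the
OPEN node U_s `SamePDropOfSkeletonFrmScaled₁`.  Lane `prim-bschramm`, seat `prim-bschramm-p3` gen 27 (design owner); helper file (`--supports
stmt-CriticalPhenomena-4575 --as helper`); DEF row (one definition, `Skelφ.StepI.DataNS.bumpR`; everything else lemmas).
WHY (WAVE-Us-MANIFEST §10 C-2, bus K-1 #5548 / Us-R3 #5570): the φ-level (R)/(C) lemmas bind ONE radius `Rs` for the short kit-route region
(`hRg : Rg c ⊆ B(c, Rs)`) and for the (S0) kit's shell / reach rows (equalities of `KS0.kit0` in `KS.Rs`); under proxies the region about `c` is the kit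
parallelogram of radius `RK + D` («SkelFrmFromBChoiceZoneKPx».hΛRg_of_atQPx, PRISM form), so the KIT must be dimensioned at a base radius `≥ RK + D`.
Two interchangeable ways to obtain such a kit from the LANDED rows (every `KS0.*` / `KS.*` row is generic in the record `D : DataNS V` and the index `mk`):
* K-1 (gen-1 g0's (C) column reads a free kit record `Dk`): `Dk := D.bumpR Dp` — §1–§3: the zone scale `M_u`, the selectors, the widths `n_s`, `M_kit`,
  `n_kit`, `h_kit`, `ℓ_kit` are UNCHANGED (`ρz = R M_u` is not bumped), `RK ↦ RK + Dp`, `RK + Dp ≤ Rs (bumpR) ≤ Rs + Dp`, `cUA ↦ (Δ+1)^(RK+Dp)`, and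
  `KS.RgK G t (D.bumpR Dp) mk ψ c` IS the radius-`RK + Dp` parallelogram (`RgK_bumpR`) — so §4 `hΛRgK_bumpR_of_atQPx` discharges the (C) rows' junction
  hypothesis `hΛRgK` at `Dk := O.merged.bumpR D` (p5-g26's forward obligation O-K1).  C-1 honoured: `bumpR` is KIT-SIDE ONLY — no `FactsNS`/`FactsO`
  equation is ever instantiated at a bumped record (none is stated here).
* K-2 (the (R) column, whose bridge `KS.B0 … mk …` mixes the long width `n_L` at `O.merged` with the kit reach `R'0 … mk`): keep the record, RAISE THE
  INDEX — §4 `mk_le_RK_of_atQ : mk ≤ KS.RK t O.merged mk` (R = fatRadius ≥ id on the Step-I record), whence `RK mk + D ≤ RK (RK mk + D)`.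
[cite: KozmaNitzan2024, §4 p. 28 ((32): the zone inside the kit region); §4 pp. 25–31] [this work]
-/

noncomputable section

open scoped Classical

namespace Summit.CriticalPhenomena.PercolationContinuityZ3.Theorems.Transplant

open MeasureTheory Literature.Probability.Percolation Literature.Probability.LatticeModels SimpleGraph KNCells KNLevels
open Literature.Barriers.CriticalPhenomena (graphBall graphBall_mono)
open SkelConc (Consts)
open Skelφ.StepI (DataN DataNS OutNS)

/-! ## §1 The bumped record (K-1) -/

namespace Skelφ.StepI

variable {V : Type}

/-- **The bumped record** `D.bumpR Dp`: the Step-I‴ record `D` with its prism-radius function raised by `Dp` at every planar scale STRICTLY ABOVE the zone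
scale `D.sM D.M₀` (`= M_u`) and unchanged at and below it; every other field (zones, seed level, thresholds, equilibrium data, selectors) is `D`'s.
A kit-side device only: it is fed to the kit functions `KS.*`/`KS0.*`, never to a `FactsNS`/`FactsO` consumer. [this work] -/
def DataNS.bumpR (D : DataNS V) (Dp : ℕ) : DataNS V :=
  { D with R := fun L => D.R L + (if D.sM D.M₀ < L then Dp else 0) }

/-- The bumped record's zones are `D`'s. [folklore] -/
@[simp] theorem DataNS.bumpR_Λ (D : DataNS V) (Dp : ℕ) : (D.bumpR Dp).Λ = D.Λ := rfl

/-- The bumped record's seed level is `D`'s. [folklore] -/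
@[simp] theorem DataNS.bumpR_k (D : DataNS V) (Dp : ℕ) : (D.bumpR Dp).k = D.k := rfl

/-- The bumped record's zone-size threshold is `D`'s. [folklore] -/
@[simp] theorem DataNS.bumpR_M₀ (D : DataNS V) (Dp : ℕ) : (D.bumpR Dp).M₀ = D.M₀ := rfl

/-- The bumped record's width threshold is `D`'s. [folklore] -/
@[simp] theorem DataNS.bumpR_n₁ (D : DataNS V) (Dp : ℕ) : (D.bumpR Dp).n₁ = D.n₁ := rfl

/-- The bumped record's shear is `D`'s. [folklore] -/
@[simp] theorem DataNS.bumpR_hgt (D : DataNS V) (Dp : ℕ) : (D.bumpR Dp).hgt = D.hgt := rfl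

/-- The bumped record's half-length is `D`'s. [folklore] -/
@[simp] theorem DataNS.bumpR_len (D : DataNS V) (Dp : ℕ) : (D.bumpR Dp).len = D.len := rfl

/-- The bumped record's split point is `D`'s. [folklore] -/
@[simp] theorem DataNS.bumpR_spl (D : DataNS V) (Dp : ℕ) : (D.bumpR Dp).spl = D.spl := rfl

/-- The bumped record's zone-size selector is `D`'s. [folklore] -/
@[simp] theorem DataNS.bumpR_sM (D : DataNS V) (Dp : ℕ) : (D.bumpR Dp).sM = D.sM := rfl

/-- The bumped record's width selector is `D`'s. [folklore] -/
@[simp] theorem DataNS.bumpR_sN (D : DataNS V) (Dp : ℕ) : (D.bumpR Dp).sN = D.sN := rfl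

/-- The bumped radius function (by `rfl`). [folklore] -/
theorem DataNS.bumpR_R (D : DataNS V) (Dp L : ℕ) : (D.bumpR Dp).R L = D.R L + (if D.sM D.M₀ < L then Dp else 0) := rfl

/-- Above the zone scale the radius is raised by `Dp`. [folklore] -/
theorem DataNS.bumpR_R_of_lt (D : DataNS V) (Dp : ℕ) {L : ℕ} (h : D.sM D.M₀ < L) : (D.bumpR Dp).R L = D.R L + Dp := by
  rw [DataNS.bumpR_R, if_pos h]

/-- At and below the zone scale the radius is unchanged. [folklore] -/
theorem DataNS.bumpR_R_of_le (D : DataNS V) (Dp : ℕ) {L : ℕ} (h : L ≤ D.sM D.M₀) : (D.bumpR Dp).R L = D.R L := by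
  rw [DataNS.bumpR_R, if_neg (not_lt.2 h), add_zero]

/-- The bumped radius dominates the original one. [folklore] -/
theorem DataNS.le_bumpR_R (D : DataNS V) (Dp L : ℕ) : D.R L ≤ (D.bumpR Dp).R L := by
  rw [DataNS.bumpR_R]; exact Nat.le_add_right _ _

/-- The bumped radius is at most the original one plus `Dp`. [folklore] -/
theorem DataNS.bumpR_R_le (D : DataNS V) (Dp L : ℕ) : (D.bumpR Dp).R L ≤ D.R L + Dp := by
  rw [DataNS.bumpR_R]; split_ifs <;> omega

/-- The bumped record's link-region scales are `D`'s (they read the shear and the half-length only). [folklore] -/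
@[simp] theorem DataNS.bumpR_scale (D : DataNS V) (Dp : ℕ) (t : V) (M n : ℕ) : (D.bumpR Dp).toDataN.scale t M n = D.toDataN.scale t M n := rfl

/-- Bumping by `0` is the identity. [folklore] -/
theorem DataNS.bumpR_zero (D : DataNS V) : D.bumpR 0 = D := by
  obtain ⟨⟨Λ, k, R, M₀, n₁, hgt, len, spl⟩, sM, sN, h1, h2⟩ := D
  simp [DataNS.bumpR]

end Skelφ.StepI

namespace PlanarSkeletonFrmFrom

/-! ## §2 The zone-scale data are invariant (K-1) -/

namespace Neg

variable {V : Type}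

/-- The zone scale `M_u` of the bumped record is `D`'s (by `rfl`). [folklore] -/
@[simp] theorem Mu_bumpR (D : DataNS V) (Dp : ℕ) : Mu (D.bumpR Dp) = Mu D := rfl

/-- The zone graph-radius `ρz = R M_u` of the bumped record is `D`'s (the bump is strictly above `M_u`). [folklore] -/
@[simp] theorem ρz_bumpR (D : DataNS V) (Dp : ℕ) : ρz (D.bumpR Dp) = ρz D := by
  unfold ρz
  rw [Mu_bumpR]
  exact DataNS.bumpR_R_of_le D Dp le_rfl

/-- The short width `n_s` of the bumped record is `D`'s. [folklore] -/
@[simp] theorem nS_bumpR (D : DataNS V) (Dp : ℕ) : nS (D.bumpR Dp) = nS D := by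
  simp only [nS, ρz_bumpR, Mu_bumpR, DataNS.bumpR_sN, DataNS.bumpR_M₀, DataNS.bumpR_n₁]

end Neg

/-! ## §3 The kit pair's widths are invariant, the kit radius is raised by `Dp` (K-1) -/

namespace NegB

namespace KS

open Neg

variable {V : Type}

/-- The kit zone size `M_kit` of the bumped record is `D`'s. [folklore] -/
@[simp] theorem MK_bumpR (D : DataNS V) (mk Dp : ℕ) : MK (D.bumpR Dp) mk = MK D mk := by
  simp only [MK, Mu_bumpR, DataNS.bumpR_sM]

/-- The kit width `n_kit` of the bumped record is `D`'s. [folklore] -/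
@[simp] theorem nKit_bumpR (D : DataNS V) (mk Dp : ℕ) : nKit (D.bumpR Dp) mk = nKit D mk := by
  simp only [nKit, MK_bumpR, Mu_bumpR, ρz_bumpR, DataNS.bumpR_sN, DataNS.bumpR_n₁]

/-- The kit shear `h_kit` of the bumped record is `D`'s. [folklore] -/
@[simp] theorem hKit_bumpR (t : V) (D : DataNS V) (mk Dp : ℕ) : hKit t (D.bumpR Dp) mk = hKit t D mk := by
  simp only [hKit, MK_bumpR, nKit_bumpR, DataNS.bumpR_hgt]

/-- The kit half-length `ℓ_kit` of the bumped record is `D`'s. [folklore] -/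
@[simp] theorem ℓKit_bumpR (t : V) (D : DataNS V) (mk Dp : ℕ) : ℓKit t (D.bumpR Dp) mk = ℓKit t D mk := by
  simp only [ℓKit, MK_bumpR, nKit_bumpR, DataNS.bumpR_len]

/-- The kit split point `v_kit` of the bumped record is `D`'s. [folklore] -/
@[simp] theorem vKit_bumpR (t : V) (D : DataNS V) (mk Dp : ℕ) : vKit t (D.bumpR Dp) mk = vKit t D mk := by
  simp only [vKit, MK_bumpR, nKit_bumpR, DataNS.bumpR_spl]

/-- The kit pair's link-region scale lies strictly above the zone scale: `M_u < scale(t, M_kit, n_kit)` (as `scale ≥ n_kit ≥ M_u + 3`). [folklore] -/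
theorem Mu_lt_scaleKit (t : V) (D : DataNS V) (mk : ℕ) : Mu D < D.toDataN.scale t (MK D mk) (nKit D mk) := by
  have h := (nKit_facts D mk).2.2.2.1
  exact lt_of_lt_of_le (by omega) (le_max_left _ _)

/-- **The kit radius of the bumped record is raised by `Dp`**: `RK t (D.bumpR Dp) mk = RK t D mk + Dp`. [folklore] -/
@[simp] theorem RK_bumpR (t : V) (D : DataNS V) (mk Dp : ℕ) : RK t (D.bumpR Dp) mk = RK t D mk + Dp := by
  unfold RK
  rw [MK_bumpR, nKit_bumpR]
  show (D.bumpR Dp).R ((D.bumpR Dp).toDataN.scale t (MK D mk) (nKit D mk)) = D.R (D.toDataN.scale t (MK D mk) (nKit D mk)) + Dp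
  rw [DataNS.bumpR_scale]
  exact DataNS.bumpR_R_of_lt D Dp (Mu_lt_scaleKit t D mk)

/-- The short-region radius of the bumped record: `Rs t (D.bumpR Dp) mk = max (RK t D mk + Dp) (ρz D)`. [folklore] -/
theorem Rs_bumpR (t : V) (D : DataNS V) (mk Dp : ℕ) : Rs t (D.bumpR Dp) mk = max (RK t D mk + Dp) (ρz D) := by
  simp only [Rs, RK_bumpR, ρz_bumpR]

/-- `RK + Dp ≤ Rs (bumpR Dp)` — the radius-`RK + Dp` parallelogram fits the bumped kit's base radius. [folklore] -/
theorem RK_add_le_Rs_bumpR (t : V) (D : DataNS V) (mk Dp : ℕ) : RK t D mk + Dp ≤ Rs t (D.bumpR Dp) mk := by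
  rw [Rs_bumpR]; exact le_max_left _ _

/-- `Rs (bumpR Dp) ≤ Rs + Dp`. [folklore] -/
theorem Rs_bumpR_le (t : V) (D : DataNS V) (mk Dp : ℕ) : Rs t (D.bumpR Dp) mk ≤ Rs t D mk + Dp := by
  rw [Rs_bumpR]; unfold Rs; omega

/-- `Rs ≤ Rs (bumpR Dp)`. [folklore] -/
theorem Rs_le_Rs_bumpR (t : V) (D : DataNS V) (mk Dp : ℕ) : Rs t D mk ≤ Rs t (D.bumpR Dp) mk := by
  rw [Rs_bumpR]; unfold Rs; omega

/-- **The kit region of the bumped record IS the radius-`RK + Dp` parallelogram about `c`** at the ORIGINAL kit pair `(n_kit, h_kit, ℓ_kit)` — the PRISM form of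
«SkelFrmFromBChoiceZoneKPx».hΛRg_of_atQPx. [folklore] -/
theorem RgK_bumpR {G : SimpleGraph V} [G.LocallyFinite] (t : V) (D : DataNS V) (mk Dp : ℕ) (ψ : V → Site 2) (c : V) :
    RgK G t (D.bumpR Dp) mk ψ c = Skelφ.pgramPrismFin G ψ c (nKit D mk) (hKit t D mk) (3 * ℓKit t D mk) (RK t D mk + Dp) := by
  simp only [RgK, nKit_bumpR, hKit_bumpR, ℓKit_bumpR, RK_bumpR]

/-- The region-cardinality budget of the bumped record: `cUA Φ t (D.bumpR Dp) mk = (Δ+1)^(RK + Dp)` (the `+ D` entering the union-bound budget, C-2). [folklore] -/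
theorem cUA_bumpR {G : SimpleGraph V} [G.LocallyFinite] (Φ : PlanarSkeletonFrmFrom G) (t : V) (D : DataNS V) (mk Dp : ℕ) :
    cUA Φ t (D.bumpR Dp) mk = (Φ.Δ + 1) ^ (RK t D mk + Dp) := by
  simp only [cUA, RK_bumpR]

/-- Bumping by `0` changes no kit quantity (`RgK`, by `bumpR_zero`). [folklore] -/
theorem RgK_bumpR_zero {G : SimpleGraph V} [G.LocallyFinite] (t : V) (D : DataNS V) (mk : ℕ) (ψ : V → Site 2) (c : V) :
    RgK G t (D.bumpR 0) mk ψ c = RgK G t D mk ψ c := by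
  rw [DataNS.bumpR_zero]

end KS

/-! ## §4 The junctions under `AtQNQ` (K-1 for the (C) column, K-2 for the (R) column) -/

open Neg

section Junction

variable {κ : Consts} {V : Type} [DecidableEq V] [Countable V] {G : SimpleGraph V} [G.LocallyFinite] {Φ : PlanarSkeletonFrmFrom G} {t : V} {p : unitInterval}
  {hC : Φ.CylSubcritical p} {gv fv : Neg.FSlot} {Pv : PSlot} {Sv : SSlot} {cv : CSlot} {bv : BSlot} {O : OutNS V} {q : unitInterval} {D : ℕ}

/-- **(K-1) THE (C)/(R) ROWS' JUNCTION HYPOTHESIS `hΛRgK` AT THE BUMPED RECORD**: under proxies, for every kit index `mk` and every centre `c`, the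
consumer-side zone `Λ (prox c) M_u` lies in the kit region of the bumped record `O.merged.bumpR D` about `c` (= the radius-`RK + D` parallelogram,
«SkelFrmFromBChoiceZoneKPx».hΛRg_of_atQPx; width floor `D ≤ n_kit`). [cite: KozmaNitzan2024, §4 p. 28 ((32))] -/
theorem hΛRgK_bumpR_of_atQPx (mk : ℕ) (hAt : (choiceAtQ3 κ Φ t p Pv gv fv Sv cv bv hC).AtQNQ O q) (hP : Φ.HasProxies t D) (hn : D ≤ KS.nKit O.merged mk) :
    ∀ c, O.merged.Λ (hP.prox c) (Mu O.merged) ⊆ KS.RgK G t (O.merged.bumpR D) mk (KS.φK Φ t O.D O.DT.toDataN O.ori mk) c := by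
  intro c a ha
  rw [KS.RgK_bumpR]
  exact (Skelφ.mem_pgramPrismFin G (KS.φK Φ t O.D O.DT.toDataN O.ori mk)).2 (hΛRg_of_atQPx mk hAt hP hn c (Finset.mem_coe.2 ha))

/-- The seed-level zone under proxies in the same bumped kit region (`Λ (prox c) k ⊆ Λ (prox c) M_u`). [folklore] -/
theorem hΛRgKk_bumpR_of_atQPx (mk : ℕ) (hAt : (choiceAtQ3 κ Φ t p Pv gv fv Sv cv bv hC).AtQNQ O q) (hP : Φ.HasProxies t D) (hn : D ≤ KS.nKit O.merged mk) :
    ∀ c, O.merged.Λ (hP.prox c) O.merged.k ⊆ KS.RgK G t (O.merged.bumpR D) mk (KS.φK Φ t O.D O.DT.toDataN O.ori mk) c :=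
  fun c => (zone_k_subset_zone_Mu hAt (hP.prox c)).trans (hΛRgK_bumpR_of_atQPx mk hAt hP hn c)

/-- **(K-2) THE KIT INDEX IS BELOW ITS OWN KIT RADIUS** on the Step-I record: `mk ≤ KS.RK t O.merged mk` (`R = fatRadius ≥ id`, `scale ≥ n_kit > M_kit ≥ mk`);
so the raised index `mkP := RK mk + D` serves `RK mk + D ≤ RK mkP`. [folklore] -/
theorem mk_le_RK_of_atQ (mk : ℕ) (hAt : (choiceAtQ3 κ Φ t p Pv gv fv Sv cv bv hC).AtQNQ O q) : mk ≤ KS.RK t O.merged mk := by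
  obtain ⟨-, -, -, hReq, -⟩ := Skelφ.StepI.OutO.FactsO.seed hAt.1.factsO
  have h1 := (KS.MK_facts O.merged mk).2.2.2
  have h2 := (KS.nKit_facts O.merged mk).2.1
  have h3 : KS.nKit O.merged mk ≤ O.merged.scale t (KS.MK O.merged mk) (KS.nKit O.merged mk) := le_max_left _ _
  have hReq' : ∀ n, O.merged.R n = Skelφ.fatRadius Φ.frame hC n := fun n => congrFun hReq n
  unfold KS.RK
  rw [hReq']
  exact le_trans (by omega) (h3.trans (Skelφ.le_fatRadius Φ.frame hC _))

/-- **(K-2) THE RAISED INDEX `mkP := RK mk + D`** clears `RK mk + D ≤ RK mkP`. [folklore] -/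
theorem RK_add_le_RK_raise_of_atQ (mk : ℕ) (hAt : (choiceAtQ3 κ Φ t p Pv gv fv Sv cv bv hC).AtQNQ O q) :
    KS.RK t O.merged mk + D ≤ KS.RK t O.merged (KS.RK t O.merged mk + D) :=
  mk_le_RK_of_atQ _ hAt

end Junction

end NegB

end PlanarSkeletonFrmFrom

end Summit.CriticalPhenomena.PercolationContinuityZ3.Theorems.Transplant

end
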